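import Mathlib
import HarnessLib
import Summits.Ventures.LatticeQCDFlow.Scaling.AcceptanceGiniFloor

/-!
# LatticeQCDFlow / Scaling — no ESS ceiling for the acceptance: at every fixed population ESS the
# equilibrium acceptance of an independence sampler can be arbitrarily close to `1`

HONEST FRAMING: exact (Metropolis-corrected) sampling algorithms for lattice gauge theory;
figures of merit are autocorrelation/cost numbers at stated couplings and volumes; no
continuum-physics claim.

Venture `LatticeQCDFlow` (cell pub-lqcd), topic `Scaling`; FANOUT row 3 (`s0-u1-a`, S0-B
implementation A, GEN-8).  NEW WORK of the cell (a two-point computation), not a published result;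
NO definition is introduced.  Companion of row 3's `Scaling/AcceptanceEssEightNinths` (the sharp
FLOOR `acc ≥ (8/9)·ESS`): there is NO CEILING — the relation between the two printed flow
diagnostics is one-sided.  (Row 2's `Exactness/IMHAcceptanceGeESS` lists "any upper bound on `ā` in
terms of `κ` alone" as NOT CLAIMED; this file shows none exists.)

## The rare heavy weight (two points; `V > 0`, `0 < s ≤ 1`, `D = V + s²`): model
## `q = (V/D, s²/D)`, target `p = (V(1 − s)/D, s(s + V)/D)`, weights `w = (1 − s, 1 + V/s)`

* `heavyTail_weights`, `heavyTail_sums` — the weights, `Σ p = Σ q = 1`;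
* **`heavyTail_essFrac`** — `ESS = 1/(1 + V)` for EVERY `s` (`Var_q w = V`);
* **`heavyTail_accRate`** — `acc = 1 − V s/(V + s²) ≥ 1 − s`;
* **`exists_accRate_gt_of_essFrac`** — for every `e ∈ (0, 1)` and `δ > 0` a normalised pair on two
  points (`p ≥ 0`, `q > 0`) with `essFrac = e` EXACTLY and `acc > 1 − δ`: a model that is exact
  except for a rare configuration of huge weight accepts almost always while its ESS is anything;
  the acceptance monitor alone cannot certify the ESS (the converse certification,
  `ESS ≤ (9/8)·acc`, is `Scaling/AcceptanceEssEightNinths`).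

NOT CLAIMED: anything about chains, volumes or trained flows; nothing re-scored.
-/

namespace Summit.Ventures.LatticeQCDFlow.Theory2

open Finset
open Literature.Probability.MarkovChains
open Summit.Ventures.LatticeQCDFlow.Exactness

/-- The heavy-tail pair's weights: `w₀ = 1 − s`, `w₁ = (s + V)/s`. -/
theorem heavyTail_weights {V s : ℝ} (hV : 0 < V) (hs : 0 < s) :
    weight ![V * (1 - s) / (V + s ^ 2), s * (s + V) / (V + s ^ 2)] ![V / (V + s ^ 2), s ^ 2 / (V + s ^ 2)] 0
        = 1 - s ∧
      weight ![V * (1 - s) / (V + s ^ 2), s * (s + V) / (V + s ^ 2)] ![V / (V + s ^ 2), s ^ 2 / (V + s ^ 2)] 1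
        = (s + V) / s := by
  have hD : V + s ^ 2 ≠ 0 := by positivity
  constructor
  · show V * (1 - s) / (V + s ^ 2) / (V / (V + s ^ 2)) = 1 - s
    rw [div_div_div_cancel_right₀ hD, mul_div_cancel_left₀ _ hV.ne']
  · show s * (s + V) / (V + s ^ 2) / (s ^ 2 / (V + s ^ 2)) = (s + V) / s
    rw [div_div_div_cancel_right₀ hD, sq, mul_div_mul_left _ _ hs.ne']

/-- The heavy-tail pair is normalised, with non-negative target and positive model (`s ≤ 1`). -/
theorem heavyTail_sums {V s : ℝ} (hV : 0 < V) (hs : 0 < s) (hs1 : s ≤ 1) :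
    (∀ x, 0 ≤ ![V * (1 - s) / (V + s ^ 2), s * (s + V) / (V + s ^ 2)] x) ∧
    (∀ x, 0 < ![V / (V + s ^ 2), s ^ 2 / (V + s ^ 2)] x) ∧
    ∑ x, ![V * (1 - s) / (V + s ^ 2), s * (s + V) / (V + s ^ 2)] x = 1 ∧
    ∑ x, ![V / (V + s ^ 2), s ^ 2 / (V + s ^ 2)] x = 1 := by
  have hDpos : 0 < V + s ^ 2 := by positivity
  have hD : V + s ^ 2 ≠ 0 := hDpos.ne'
  refine ⟨?_, ?_, ?_, ?_⟩
  · intro x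
    fin_cases x
    · exact div_nonneg (mul_nonneg hV.le (by linarith)) hDpos.le
    · exact div_nonneg (mul_nonneg hs.le (by linarith)) hDpos.le
  · intro x
    fin_cases x
    · exact div_pos hV hDpos
    · exact div_pos (pow_pos hs 2) hDpos
  · rw [Fin.sum_univ_two]
    show V * (1 - s) / (V + s ^ 2) + s * (s + V) / (V + s ^ 2) = 1
    rw [← add_div, div_eq_one_iff_eq hD]
    ring
  · rw [Fin.sum_univ_two]
    show V / (V + s ^ 2) + s ^ 2 / (V + s ^ 2) = 1
    rw [← add_div, div_eq_one_iff_eq hD]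

/-- **The heavy-tail pair has `ESS = 1/(1 + V)` for every `s`.** [folklore] -/
theorem heavyTail_essFrac {V s : ℝ} (hV : 0 < V) (hs : 0 < s) (hs1 : s ≤ 1) :
    essFrac ![V * (1 - s) / (V + s ^ 2), s * (s + V) / (V + s ^ 2)]
        ![V / (V + s ^ 2), s ^ 2 / (V + s ^ 2)] = 1 / (1 + V) := by
  obtain ⟨-, hq, hp1, -⟩ := heavyTail_sums hV hs hs1
  obtain ⟨w0, w1⟩ := heavyTail_weights hV hs
  have hD : V + s ^ 2 ≠ 0 := by positivity
  have h := sum_mul_weight_sq_eq_inv_essFrac hq hp1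
  rw [Fin.sum_univ_two, w0, w1] at h
  have h2 : ![V / (V + s ^ 2), s ^ 2 / (V + s ^ 2)] 0 * (1 - s) ^ 2
      + ![V / (V + s ^ 2), s ^ 2 / (V + s ^ 2)] 1 * ((s + V) / s) ^ 2 = 1 + V := by
    show V / (V + s ^ 2) * (1 - s) ^ 2 + s ^ 2 / (V + s ^ 2) * ((s + V) / s) ^ 2 = 1 + V
    field_simp
    ring
  rw [h2] at h
  have := congrArg (·⁻¹) h
  simp only [inv_inv] at this
  rw [← this, one_div]

/-- **The heavy-tail pair has `acc = 1 − V s/(V + s²)`.** [folklore] -/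
theorem heavyTail_accRate {V s : ℝ} (hV : 0 < V) (hs : 0 < s) :
    accRate ![V * (1 - s) / (V + s ^ 2), s * (s + V) / (V + s ^ 2)]
        ![V / (V + s ^ 2), s ^ 2 / (V + s ^ 2)] = 1 - V * s / (V + s ^ 2) := by
  have hDpos : 0 < V + s ^ 2 := by positivity
  have hD : V + s ^ 2 ≠ 0 := hDpos.ne'
  unfold accRate
  simp only [Fin.sum_univ_two, Matrix.cons_val_zero, Matrix.cons_val_one, min_self]
  -- the off-diagonal term: `p₀ q₁ ≤ p₁ q₀`
  have hle : V * (1 - s) / (V + s ^ 2) * (s ^ 2 / (V + s ^ 2))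
      ≤ s * (s + V) / (V + s ^ 2) * (V / (V + s ^ 2)) := by
    rw [div_mul_div_comm, div_mul_div_comm]
    refine div_le_div_of_nonneg_right ?_ (by positivity)
    nlinarith [mul_pos hV hs, pow_pos hs 2, mul_pos (mul_pos hV hs) hs]
  rw [min_eq_left hle, min_eq_right hle]
  field_simp
  ring

/-- **No ESS ceiling for the acceptance.**  For every population ESS fraction `e ∈ (0, 1)` and every
`δ > 0` there is a normalised pair on two points (`p ≥ 0`, `q > 0`) with `essFrac = e` exactly and
`acc > 1 − δ` (the heavy-tail pair with `V = 1/e − 1`, `s = min(1, δ/2)`: `acc ≥ 1 − s`).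
[folklore] -/
theorem exists_accRate_gt_of_essFrac {e δ : ℝ} (he0 : 0 < e) (he1 : e < 1) (hδ : 0 < δ) :
    ∃ p q : Fin 2 → ℝ, (∀ x, 0 ≤ p x) ∧ (∀ x, 0 < q x) ∧ ∑ x, p x = 1 ∧ ∑ x, q x = 1 ∧
      essFrac p q = e ∧ 1 - δ < accRate p q := by
  set V : ℝ := 1 / e - 1 with hV
  have hVpos : 0 < V := by
    rw [hV, sub_pos, lt_div_iff₀ he0]; linarith
  set s : ℝ := min 1 (δ / 2) with hs
  have hs0 : 0 < s := lt_min one_pos (by linarith)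
  have hs1 : s ≤ 1 := min_le_left _ _
  have hsδ : s < δ := lt_of_le_of_lt (min_le_right _ _) (by linarith)
  obtain ⟨hp0, hq, hp1, hq1⟩ := heavyTail_sums hVpos hs0 hs1
  refine ⟨_, _, hp0, hq, hp1, hq1, ?_, ?_⟩
  · rw [heavyTail_essFrac hVpos hs0 hs1, hV]
    have : e ≠ 0 := he0.ne'
    field_simp
    ring
  · rw [heavyTail_accRate hVpos hs0]
    have hDpos : 0 < V + s ^ 2 := by positivity
    have h1 : V * s / (V + s ^ 2) ≤ s := by
      rw [div_le_iff₀ hDpos]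
      nlinarith [pow_pos hs0 3]
    linarith

end Summit.Ventures.LatticeQCDFlow.Theory2
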